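import Literature.AlgebraicGeometry.AbelianSchemes.AbelianSchemeOverRingAction   -- ★ `RingAction` (`i_one`, `i_mul`, `i_add`)
import Literature.AlgebraicGeometry.AbelianSchemes.AbelianSchemeOverField        -- ★ `toAffine.toAbelianVariety`, points
import Mathlib.RingTheory.Ideal.Operations
import HarnessLib

/-!
# Coprime splitting of ideal torsion ON POINTS: a `ι`-stable subgroup `K ⊆ A(Ω)[𝔞𝔟]`, `𝔞 + 𝔟 = (1)`, has `#K = #K[𝔞] · #K[𝔟]`
# ([Neukirch1999] Ch. I (3.6); [AtiyahMacdonald1969] Prop. 1.10; [Tate1997FiniteFlatGroupSchemes] (1.6)–(1.7))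

Topic `Literature/AlgebraicGeometry/AbelianSchemes`; namespace `Literature.AlgebraicGeometry.AbelianSchemes.AbelianSchemeOver.RingAction`.  THEOREMS ONLY (no
definition, no named fact, no `instance`, no notation, no `sorry`).  Cell `hodgecm-mathlib` (D-0151), F0∕P6 «MOD», line L2 (socket `stub_DOWN`), organ (ρ2‴)-D
«THE `w`-PART OF THE ROOF KERNEL» (LA2-p03 (g2), 2026-09-02; consumer: the (k2b)-PACK step (s3) of LA2-plan (g2) 07:37:13Z, «`K ∩ A_y[𝔭_w](Ω̄)` has order `q`»).
The POINTS-level twin of ★ `GroupSchemes/IdealTorsionCoprimeSplittingRank` (which splits the RANK of a finite group scheme killed by `𝔞𝔟`): here the plain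
group `A(Ω)` of `Ω`-points of an abelian scheme `A ∕ Spec Ω` with an `𝒪`-action `act` (★ `RingAction`, currency `AlgPoints.map (act.i a) P = 1` of ★ (ρ2″)
`RoofKernelIdealTorsion`).  `--supports stmt-HodgeConjecture-24832`, count-neutral.  HC_CM is proved only modulo the cell's printed citations (2 remaining named
inputs: hLiu418 = stmt-HodgeConjecture-24832, h413 = stmt-HodgeConjecture-24833) until rung 0 closes; this file is generic and discharges none of them.

THE MATHEMATICS.  Let `e ∈ 𝒪` be a CRT element for the comaximal pair `𝔞 + 𝔟 = (1)`: `e − 1 ∈ 𝔞`, `e ∈ 𝔟` ([Neukirch1999] I (3.6)).  On a point `P` killed by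
`ι(𝔞𝔟)`, `ι(e)P` is killed by `ι(𝔞)` (`a e ∈ 𝔞𝔟`) and `ι(1−e)P` by `ι(𝔟)` (`(1−e) b ∈ 𝔞𝔟`), and `P = ι(1)P = ι(e)P · ι(1−e)P` (`ι` is additive into the group
`Hom(A, A)`); on `𝔞`-torsion points `ι(e)` is the identity (`e − 1 ∈ 𝔞`) and on `𝔟`-torsion points it is trivial (`e ∈ 𝔟`).  Hence for a `ι`-stable subgroup
`K` killed by `ι(𝔞𝔟)` the map `P ↦ (ι(e)P, ι(1−e)P)` is a bijection `K ≃ K[𝔞] × K[𝔟]` with inverse the multiplication, and **`#K = #K[𝔞] · #K[𝔟]`**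
([AtiyahMacdonald1969] Prop. 1.10: `M[𝔞𝔟] = M[𝔞] ⊕ M[𝔟]`).

* §1 `comp_i_mul_pt`, `comp_i_add_pt`, `comp_i_one_pt` — pointwise laws of `ι` on points typed `specOver Ω Ω ⟶ A.X`; `comp_i_eq_self_of_torsion_of_sub_one_mem`,
  `torsion_comp_i_of_torsion_mul(')` — the CRT element on torsion points.
* §2 **`natCard_eq_mul_of_idealTorsion_mul'`** (`Hom`-currency) and **`natCard_eq_mul_of_idealTorsion_mul`** (`AlgPoints.map` currency) — the count.

## References
* [Neukirch1999] J. Neukirch, *Algebraic Number Theory* (1999), Ch. I §3 (3.6) (Chinese remainder theorem).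
* [AtiyahMacdonald1969] M. Atiyah, I. Macdonald, *Introduction to Commutative Algebra* (1969), Prop. 1.10.
* [Tate1997FiniteFlatGroupSchemes] J. Tate, *Finite flat group schemes* (1997), (1.6)–(1.7).
-/

set_option autoImplicit false

noncomputable section

universe u

open CategoryTheory CategoryTheory.Limits AlgebraicGeometry MonoidalCategory CartesianMonoidalCategory
open scoped MonObj
open Literature.AlgebraicGeometry.Motives (AlgPoints SchemeOver specOver)

namespace Literature.AlgebraicGeometry.AbelianSchemes

namespace AbelianSchemeOver

namespace RingAction

variable {Ω : Type u} [Field Ω] {A : AbelianSchemeOver (Spec (.of Ω))} {O : Type*} [CommRing O] (act : A.RingAction O)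

/-! ## §1 Pointwise laws of `ι` on `Ω`-points (typed `specOver Ω Ω ⟶ A.X`); the CRT element on torsion points -/

/-- `x ≫ ι(ab) = (x ≫ ι(b)) ≫ ι(a)` (`ι(ab) = ι(b) ≫ ι(a)`). [cite: Kottwitz1992, §5 (p. 390)] -/
theorem comp_i_mul_pt (a b : O) (x : specOver Ω Ω ⟶ A.X) : x ≫ act.i (a * b) = (x ≫ act.i b) ≫ act.i a := by
  rw [act.i_mul, Category.assoc]

/-- `x ≫ ι(a+b) = (x ≫ ι(a)) · (x ≫ ι(b))` (`ι` is additive into the group `Hom(A, A)`, Mathlib `MonObj.comp_mul`). [cite: Kottwitz1992, §5 (p. 390)] -/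
theorem comp_i_add_pt (a b : O) (x : specOver Ω Ω ⟶ A.X) : x ≫ act.i (a + b) = (x ≫ act.i a) * (x ≫ act.i b) := by
  rw [act.i_add, MonObj.comp_mul]

/-- `x ≫ ι(1) = x`. [cite: Kottwitz1992, §5 (p. 390)] -/
theorem comp_i_one_pt (x : specOver Ω Ω ⟶ A.X) : x ≫ act.i 1 = x := by
  rw [act.i_one, Category.comp_id]

/-- **On an `𝔞`-torsion point a CRT element `e ≡ 1 (mod 𝔞)` acts as the identity**: `x ≫ ι(e) = (x ≫ ι(e−1)) · (x ≫ ι(1)) = x`. [cite: Neukirch1999, Ch. I §3 (3.6)] -/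
theorem comp_i_eq_self_of_torsion_of_sub_one_mem {𝔞 : Ideal O} {e : O} (he : e - 1 ∈ 𝔞) (x : specOver Ω Ω ⟶ A.X)
    (hx : ∀ a ∈ 𝔞, x ≫ act.i a = 1) : x ≫ act.i e = x := by
  have h : e = (e - 1) + 1 := by ring
  rw [h, comp_i_add_pt, hx _ he, one_mul, comp_i_one_pt]

/-- **`x ≫ ι(c)` is `𝔞`-torsion when `x` is `𝔞𝔟`-torsion and `c ∈ 𝔟`** (`a c ∈ 𝔞𝔟`). [cite: AtiyahMacdonald1969, Prop. 1.10] -/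
theorem torsion_comp_i_of_torsion_mul {𝔞 𝔟 : Ideal O} {c : O} (hc : c ∈ 𝔟) (x : specOver Ω Ω ⟶ A.X)
    (hx : ∀ r ∈ 𝔞 * 𝔟, x ≫ act.i r = 1) : ∀ a ∈ 𝔞, (x ≫ act.i c) ≫ act.i a = 1 := by
  intro a ha
  rw [← comp_i_mul_pt]
  exact hx _ (Ideal.mul_mem_mul ha hc)

/-- The symmetric statement: `x ≫ ι(c)` is `𝔟`-torsion when `x` is `𝔞𝔟`-torsion and `c ∈ 𝔞`. [cite: AtiyahMacdonald1969, Prop. 1.10] -/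
theorem torsion_comp_i_of_torsion_mul' {𝔞 𝔟 : Ideal O} {c : O} (hc : c ∈ 𝔞) (x : specOver Ω Ω ⟶ A.X)
    (hx : ∀ r ∈ 𝔞 * 𝔟, x ≫ act.i r = 1) : ∀ b ∈ 𝔟, (x ≫ act.i c) ≫ act.i b = 1 := by
  intro b hb
  rw [← comp_i_mul_pt]
  have : b * c ∈ 𝔞 * 𝔟 := by rw [mul_comm b c]; exact Ideal.mul_mem_mul hc hb
  exact hx _ this

/-! ## §2 The count -/

set_option maxHeartbeats 400000 in
/-- **COPRIME SPLITTING OF IDEAL TORSION ON POINTS, `Hom`-currency: `#K = #K[𝔞] · #K[𝔟]`** for a `ι`-stable subgroup `K` of `Ω`-points (typed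
`specOver Ω Ω ⟶ A.X`) killed by `ι(𝔞𝔟)`, `𝔞 + 𝔟 = (1)`: the map `x ↦ (x ≫ ι(e), x ≫ ι(1−e))` (`e ≡ 1 (mod 𝔞)`, `e ∈ 𝔟`) is a bijection `K ≃ K[𝔞] × K[𝔟]`
with inverse the multiplication. [cite: AtiyahMacdonald1969, Prop. 1.10] [cite: Neukirch1999, Ch. I §3 (3.6)] [cite: Tate1997FiniteFlatGroupSchemes, (1.6)–(1.7)] -/
theorem natCard_eq_mul_of_idealTorsion_mul' [IsCommMonObj A.X] (𝔞 𝔟 : Ideal O) (h𝔞𝔟 : 𝔞 ⊔ 𝔟 = ⊤)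
    (K : Subgroup (specOver Ω Ω ⟶ A.X))
    (hK : ∀ x ∈ K, ∀ r ∈ 𝔞 * 𝔟, x ≫ act.i r = 1) (hst : ∀ a, ∀ x ∈ K, x ≫ act.i a ∈ K) :
    Nat.card ↥K =
      Nat.card {x : specOver Ω Ω ⟶ A.X // x ∈ K ∧ ∀ a ∈ 𝔞, x ≫ act.i a = 1} *
      Nat.card {x : specOver Ω Ω ⟶ A.X // x ∈ K ∧ ∀ b ∈ 𝔟, x ≫ act.i b = 1} := by
  -- a CRT element: `e - 1 ∈ 𝔞`, `e ∈ 𝔟`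
  obtain ⟨i, hi, e, he, hie⟩ := Ideal.isCoprime_iff_exists.mp (Ideal.isCoprime_iff_sup_eq.mpr h𝔞𝔟)
  have he1 : e - 1 ∈ 𝔞 := by
    have : e - 1 = -i := by rw [← hie]; ring
    rw [this]; exact 𝔞.neg_mem hi
  have h1e : 1 - e ∈ 𝔞 := by rw [← hie, add_sub_cancel_right]; exact hi
  have h1e' : (1 - e) - 1 ∈ 𝔟 := by
    have : (1 - e) - 1 = -e := by ring
    rw [this]; exact 𝔟.neg_mem he
  haveI := act.isMonHom e
  haveI := act.isMonHom (1 - e)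
  rw [← Nat.card_prod]
  refine Nat.card_congr
    { toFun := fun P => ⟨⟨P.1 ≫ act.i e, hst e P.1 P.2, torsion_comp_i_of_torsion_mul act he P.1 (hK P.1 P.2)⟩,
        ⟨P.1 ≫ act.i (1 - e), hst (1 - e) P.1 P.2, torsion_comp_i_of_torsion_mul' act h1e P.1 (hK P.1 P.2)⟩⟩
      invFun := fun Q => ⟨Q.1.1 * Q.2.1, K.mul_mem Q.1.2.1 Q.2.2.1⟩
      left_inv := fun P => ?_
      right_inv := fun Q => ?_ }
  · -- `(x ≫ ι(e)) · (x ≫ ι(1-e)) = x ≫ ι(1) = x`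
    apply Subtype.ext
    change (P.1 ≫ act.i e) * (P.1 ≫ act.i (1 - e)) = P.1
    rw [← comp_i_add_pt, add_sub_cancel, comp_i_one_pt]
  · -- `(xy) ≫ ι(e) = x`, `(xy) ≫ ι(1-e) = y` for `x` `𝔞`-torsion, `y` `𝔟`-torsion
    obtain ⟨⟨x, hxK, hx⟩, ⟨y, hyK, hy⟩⟩ := Q
    have hxy_e : (x * y) ≫ act.i e = x := by
      rw [MonObj.mul_comp, comp_i_eq_self_of_torsion_of_sub_one_mem act he1 x hx, hy e he, mul_one]
    have hxy_1e : (x * y) ≫ act.i (1 - e) = y := by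
      rw [MonObj.mul_comp, hx (1 - e) h1e, comp_i_eq_self_of_torsion_of_sub_one_mem act h1e' y hy, one_mul]
    exact Prod.ext (Subtype.ext hxy_e) (Subtype.ext hxy_1e)

set_option maxHeartbeats 400000 in
/-- **COPRIME SPLITTING OF IDEAL TORSION ON POINTS: `#K = #K[𝔞] · #K[𝔟]`** — the same in the `A.toAffine.toAbelianVariety.Points Ω` ∕ `AlgPoints.map (act.i a) P = 1`
currency of ★ (ρ2″) `RoofKernelIdealTorsion` (the two spellings agree definitionally).  The points-level twin of ★
`IdealTorsionCoprimeSplitting.finrank_alg_eq_mul_of_sup_eq_top`. [cite: AtiyahMacdonald1969, Prop. 1.10] [cite: Neukirch1999, Ch. I §3 (3.6)]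
[cite: Tate1997FiniteFlatGroupSchemes, (1.6)–(1.7)] -/
theorem natCard_eq_mul_of_idealTorsion_mul [IsCommMonObj A.X] (𝔞 𝔟 : Ideal O) (h𝔞𝔟 : 𝔞 ⊔ 𝔟 = ⊤)
    (K : Subgroup (A.toAffine.toAbelianVariety.Points Ω))
    (hK : ∀ P ∈ K, ∀ x ∈ 𝔞 * 𝔟, (AlgPoints.map (act.i x) P : A.toAffine.toAbelianVariety.Points Ω) = 1)
    (hst : ∀ a, ∀ P ∈ K, (AlgPoints.map (act.i a) P : A.toAffine.toAbelianVariety.Points Ω) ∈ K) :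
    Nat.card ↥K =
      Nat.card {P : A.toAffine.toAbelianVariety.Points Ω // P ∈ K ∧ ∀ a ∈ 𝔞, (AlgPoints.map (act.i a) P : A.toAffine.toAbelianVariety.Points Ω) = 1} *
      Nat.card {P : A.toAffine.toAbelianVariety.Points Ω // P ∈ K ∧ ∀ b ∈ 𝔟, (AlgPoints.map (act.i b) P : A.toAffine.toAbelianVariety.Points Ω) = 1} :=
  natCard_eq_mul_of_idealTorsion_mul' act 𝔞 𝔟 h𝔞𝔟 K hK hst

end RingAction

end AbelianSchemeOver

end Literature.AlgebraicGeometry.AbelianSchemes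

end
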